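import Summits.CriticalPhenomena.PercolationContinuityZ3.Theorems.PercShatteringRaceRaceLemma
import Summits.CriticalPhenomena.PercolationContinuityZ3.Theorems.FreeSusceptibilityPowerSaving.Negative.FreeSusceptibilityPowerSavingBounds
import Summits.CriticalPhenomena.PercolationContinuityZ3.Theses.PercHollowCells
import HarnessLib

/-!
# Census signatures, v2 (strategist s1) — crux stmt-CriticalPhenomena-5786
# `PercShatteringRace.FreeSusceptibilityPowerSaving` = S(1/2)

Companion to `STRATEGY-CENSUS.md` v2 (crux-strategist s1, gen 1, 2026-08-17).  THIS IS NOT A LINE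
SKELETON: no `stub_*`, nothing registered.  It types the v2 census statements against the tree and
kernel-checks the cheap logical facts the census relies on:

* §D6 (the route consumes only the JUMP FORM of S):
  `SJump := 0 < θ(p_c) → S`, `SHealthy := θ(p_c) = 0 → S`, `UJump := 0 < θ(p_c) → U(1/6)`;
  `crux_iff_jump_and_healthy : S ↔ SJump ∧ SHealthy`, `sJump_of_continuity : θ(p_c)=0 → SJump`
  (SJump is a CONSEQUENCE of the summit), and `closes_of_jumpForms : SJump → UJump → RaceLemma →
  PercolationContinuityZ3` (the deciding theorem needs neither `SHealthy` nor the orthodox half of U).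
* §S⁺7 (quantifier over scales): `SIO` (S infinitely often), `SNear` (a good scale within factor 4
  above every scale); `crux_of_sNear : SNear → S` (monotonicity in `R`, constant `× 4^{5/2}`),
  `sNear_of_crux`, `sio_of_crux`; `RaceLemmaIO` (the i.o. race lemma, a provable-now SUPPORT
  candidate, recorded as a Prop only).
* §Dc9 (BK reduction of the counting child of Dc3 to the rooted child of Dc2): `AvgRoot a`,
  `NonProlif2`, and the implication `Dc9_BKReduction := AvgRoot (1/4) → NonProlif2` recorded as a
  Prop (its proof is a van den Berg–Kesten disjoint-occurrence argument, not done here).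
* §8 R5 (an existing STRONGER hub item closes S by exponent monotonicity):
  `crux_of_quantFreeBoxShattering : PercHollowCells.QuantFreeBoxShattering → S`
  (stmt-CriticalPhenomena-5837, exponent `17/8 ≤ 5/2`; a prover should land this 10-line bridge
  `--supports stmt-CriticalPhenomena-5786` so the ledger links the two items).
-/

namespace Summit.CriticalPhenomena.PercolationContinuityZ3.Cruxes.FreeSusceptibilityPowerSaving.CensusS1

open MeasureTheory Filter Topology
open Literature.Probability.Percolation Literature.Probability.LatticeModels
open Summit.CriticalPhenomena.PercolationContinuityZ3.Theses.PercShatteringRace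
open scoped Classical

noncomputable section

/-- The critical bond measure on `ℤ³`. -/
abbrev μc : Measure (BondConfig (Site 3)) := bondPercolation (zdGraph 3) (criticalProbI 3)

/-- `χᶠ_R(p_c) = Σ_{y ∈ Λ_R} P_{p_c}(0 ↔ y inside Λ_R)`, the free susceptibility of the centre. -/
def chiF (R : ℕ) : ℝ :=
  ∑ y ∈ box 3 R, μc.real (openConnIn (↑(box 3 R) : Set (Site 3)) 0 y)

/-- The crux, literally, over `chiF`. -/
theorem crux_iff_chiF :
    FreeSusceptibilityPowerSaving ↔ ∃ C : ℝ, ∀ R : ℕ, 1 ≤ R → chiF R ≤ C * (R : ℝ) ^ ((5 : ℝ) / 2) :=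
  Iff.rfl

/-- `θ(p_c)` on `ℤ³` (bond). -/
def thetaC : ℝ := theta (zdGraph 3) (0 : Site 3) (criticalProbI 3)

theorem thetaC_nonneg : 0 ≤ thetaC := measureReal_nonneg

/-- The summit conjunct is literally `θ(p_c) = 0`. -/
theorem continuity_iff_thetaC : _root_.PercolationContinuityZ3 ↔ thetaC = 0 := Iff.rfl

/-! ## §D6 — jump form / healthy form of S -/

/-- JUMP FORM of the crux: S asked only in the counterfactual world `θ(p_c) > 0`. -/
def SJump : Prop := 0 < thetaC → FreeSusceptibilityPowerSaving

/-- HEALTHY (orthodox) FORM: S asked only in the world `θ(p_c) = 0` — a pure critical-exponent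
bound (`2 − η_free ≤ 5/2` given continuity), never consumed by the route. -/
def SHealthy : Prop := thetaC = 0 → FreeSusceptibilityPowerSaving

/-- JUMP FORM of the sibling crux U(1/6) (its own lead landed the analogous remark,
`Theorems.NearLinearTwoClusterDecay.Consumed.raceLemma_jump`). -/
def UJump : Prop := 0 < thetaC → NearLinearTwoClusterDecay

/-- S is exactly the conjunction of its two world-forms (excluded middle on `θ(p_c) = 0`). -/
theorem crux_iff_jump_and_healthy : FreeSusceptibilityPowerSaving ↔ (SJump ∧ SHealthy) := by
  constructor
  · intro h
    exact ⟨fun _ => h, fun _ => h⟩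
  · rintro ⟨hJ, hH⟩
    by_cases h0 : thetaC = 0
    · exact hH h0
    · exact hJ (lt_of_le_of_ne thetaC_nonneg (Ne.symm h0))

/-- `SJump` is a CONSEQUENCE of the summit (vacuously): as a route item it would be a
weakest-unknown-consequence-type crux, honest only because `closes_of_jumpForms` uses it. -/
theorem sJump_of_continuity (h : _root_.PercolationContinuityZ3) : SJump := by
  intro hpos
  have h0 : thetaC = 0 := h
  exact absurd h0 (ne_of_gt hpos)

/-- `SJump` is implied by the crux as filed. -/
theorem sJump_of_crux (h : FreeSusceptibilityPowerSaving) : SJump := fun _ => h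

/-- **The route consumes only the jump forms.**  With the landed support `RaceLemma`
(`Theorems.raceLemma_proof`), `SJump` and `UJump` already give the sub-problem statement; the proof
is the deciding theorem's proof run after a case split on `θ(p_c) = 0`. -/
theorem closes_of_jumpForms (hS : SJump) (hU : UJump) (hR : RaceLemma) :
    _root_.PercolationContinuityZ3 := by
  by_cases hθ : thetaC = 0
  · exact hθ
  · have hpos : 0 < thetaC := lt_of_le_of_ne thetaC_nonneg (Ne.symm hθ)
    have h := hR (1 / 2) (1 / 6) (by norm_num) (by norm_num)
    have e1 : (3 : ℝ) - 1 / 2 = 5 / 2 := by norm_num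
    have e2 : (1 : ℝ) + 1 / 6 = 7 / 6 := by norm_num
    rw [e1, e2] at h
    exact h (hS hpos) (hU hpos)

/-- Same, with the support discharged by the landed theorem: `SJump → UJump → θ(p_c) = 0`. -/
theorem continuity_of_jumpForms (hS : SJump) (hU : UJump) : _root_.PercolationContinuityZ3 :=
  closes_of_jumpForms hS hU Theorems.raceLemma_proof

/-! ## §S⁺7 — quantifier over scales -/

/-- S INFINITELY OFTEN in the scale. -/
def SIO : Prop := ∃ C : ℝ, ∃ᶠ R : ℕ in atTop, chiF R ≤ C * (R : ℝ) ^ ((5 : ℝ) / 2)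

/-- S on a set of scales that is dense within factor `4` above every scale. -/
def SNear : Prop :=
  ∃ C : ℝ, ∀ R : ℕ, 1 ≤ R → ∃ R' : ℕ, R ≤ R' ∧ R' ≤ 4 * R ∧ chiF R' ≤ C * (R' : ℝ) ^ ((5 : ℝ) / 2)

theorem sio_of_crux (h : FreeSusceptibilityPowerSaving) : SIO := by
  obtain ⟨C, hC⟩ := h
  exact ⟨C, ((eventually_ge_atTop 1).mono fun R hR => hC R hR).frequently⟩

theorem sNear_of_crux (h : FreeSusceptibilityPowerSaving) : SNear := by
  obtain ⟨C, hC⟩ := h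
  exact ⟨C, fun R hR => ⟨R, le_rfl, by omega, hC R hR⟩⟩

/-- Monotonicity of `χᶠ_R` in `R` (tree: `Negative.sum_mono_R`). -/
theorem chiF_mono {R R' : ℕ} (h : R ≤ R') : chiF R ≤ chiF R' :=
  Theorems.FreeSusceptibilityPowerSaving.Negative.sum_mono_R (criticalProbI 3) h

/-- **`SNear → S`**: a good scale within factor 4 above every scale gives S outright, by
monotonicity in `R` alone (constant multiplied by `4^{5/2} = 32`).  So "S on a 4-dense set of
scales" is EQUIVALENT to S; only the genuinely sparse `SIO` is weaker. -/
theorem crux_of_sNear (h : SNear) : FreeSusceptibilityPowerSaving := by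
  obtain ⟨C, hC⟩ := h
  refine ⟨max C 0 * (4 : ℝ) ^ ((5 : ℝ) / 2), fun R hR => ?_⟩
  obtain ⟨R', hRR', hR'4, hgood⟩ := hC R hR
  have hR'0 : (0 : ℝ) ≤ (R' : ℝ) := Nat.cast_nonneg _
  have hR0 : (0 : ℝ) ≤ (R : ℝ) := Nat.cast_nonneg _
  have h4 : ((R' : ℝ)) ≤ 4 * (R : ℝ) := by exact_mod_cast hR'4
  calc chiF R ≤ chiF R' := chiF_mono hRR'
    _ ≤ C * (R' : ℝ) ^ ((5 : ℝ) / 2) := hgood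
    _ ≤ max C 0 * (R' : ℝ) ^ ((5 : ℝ) / 2) :=
        mul_le_mul_of_nonneg_right (le_max_left _ _) (Real.rpow_nonneg hR'0 _)
    _ ≤ max C 0 * (4 * (R : ℝ)) ^ ((5 : ℝ) / 2) :=
        mul_le_mul_of_nonneg_left (Real.rpow_le_rpow hR'0 h4 (by norm_num)) (le_max_right _ _)
    _ = max C 0 * (4 : ℝ) ^ ((5 : ℝ) / 2) * (R : ℝ) ^ ((5 : ℝ) / 2) := by
        rw [Real.mul_rpow (by norm_num) hR0]; ring

/-- The i.o. RACE LEMMA (support candidate, provable now by re-running `raceLemma_proof` along the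
good scales `R_k`, with `r_k = ⌊R_k^{1/(1+b)}⌋`): `S(a)` infinitely often in the scale already
suffices for the race.  Recorded as a Prop; NOT proved here (≈ 150 lines of bookkeeping). -/
def RaceLemmaIO : Prop :=
  ∀ a b : ℝ, 0 < b → (1 + b) * (3 - a) < 3 →
    (∃ C : ℝ, ∃ᶠ R : ℕ in atTop,
      ∑ y ∈ box 3 R, μc.real (openConnIn (↑(box 3 R) : Set (Site 3)) 0 y) ≤ C * (R : ℝ) ^ (3 - a)) →
    Tendsto (fun n : ℕ => μc.real
      {ω | ∃ x ∈ box 3 n, ∃ x' ∈ box 3 n, ∃ y ∈ innerBoundary (zdGraph 3) (box 3 ⌈(n : ℝ) ^ (1 + b)⌉₊),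
        ∃ y' ∈ innerBoundary (zdGraph 3) (box 3 ⌈(n : ℝ) ^ (1 + b)⌉₊),
          ω ∈ openConnIn (↑(box 3 ⌈(n : ℝ) ^ (1 + b)⌉₊) : Set (Site 3)) x y ∧
          ω ∈ openConnIn (↑(box 3 ⌈(n : ℝ) ^ (1 + b)⌉₊) : Set (Site 3)) x' y' ∧
          ω ∉ openConnIn (↑(box 3 ⌈(n : ℝ) ^ (1 + b)⌉₊) : Set (Site 3)) x x'}) atTop (𝓝 0) →
    _root_.PercolationContinuityZ3

/-! ## §Dc9 — the counting child of Dc3 is the rooted child of Dc2 (BK) -/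

/-- `avgROOT(a)`: the ROOT-AVERAGED in-box volume tail of `Λ_{2R}` at threshold `⌈R^{5/2}⌉` decays
like `R^{-a}`: `Σ_{x ∈ Λ_{2R}} P_{p_c}(|C_{2R}(x)| ≥ ⌈R^{5/2}⌉) ≤ C |Λ_{2R}| R^{-a}`. -/
def AvgRoot (a : ℝ) : Prop :=
  ∃ C : ℝ, ∀ R : ℕ, 1 ≤ R →
    (∑ x ∈ box 3 (2 * R), μc.real
      {ω | ⌈(R : ℝ) ^ ((5 : ℝ) / 2)⌉₊ ≤
        ((box 3 (2 * R)).filter fun v => ω ∈ openConnIn (↑(box 3 (2 * R)) : Set (Site 3)) x v).card})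
      ≤ C * ((box 3 (2 * R)).card : ℝ) * (R : ℝ) ^ (-a)

/-- `NONPROLIF₂(1/2)`, verbatim the second hypothesis of the landed
`Theorems.StubUnrootedSplit.stub_unrootedSplit` (Dc3 glue, p139783). -/
def NonProlif2 : Prop :=
  ∃ C : ℝ, ∀ R : ℕ, 1 ≤ R →
    ∫ ω, (((((box 3 (2 * R)).filter fun x => ⌈(R : ℝ) ^ ((5 : ℝ) / 2)⌉₊ ≤
          ((box 3 (2 * R)).filter fun v => ω ∈ openConnIn ↑(box 3 (2 * R)) x v).card).image
        fun x => (box 3 (2 * R)).filter fun v => ω ∈ openConnIn ↑(box 3 (2 * R)) x v).card : ℕ) : ℝ) ^ 2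
      ∂μc ≤ C * (R : ℝ) ^ ((1 : ℝ) / 2)

/-- **Dc9** (recorded, not proved): `avgROOT(1/4) ⇒ NONPROLIF₂(1/2)`.  Two distinct fat in-box
clusters are DISJOINT witnesses of two increasing events `{|C(x)| ≥ n}`, `{|C(y)| ≥ n}`, so BK gives
`E[N(N−1)] ≤ (n⁻¹ Σ_x P(|C_{2R}(x)| ≥ n))²` and `E N ≤ n⁻¹ Σ_x P(|C_{2R}(x)| ≥ n)`; with
`n = ⌈R^{5/2}⌉`, `|Λ_{2R}| ≤ 125 R³`: `E N² ≤ 125 C R^{1/2−a} + (125 C)² R^{1−2a} ≤ C' R^{1/2}` iff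
`a ≥ 1/4`.  Hence Dc3 ⟸ avgROOT(1/4) ∧ KMAX₄(21/2), which is WORSE than Dc2 = ROOT(1/4) ∧ KMAX₂(21/4)
and than the bk member family: the unrooted split has no independent counting content. -/
def Dc9_BKReduction : Prop := AvgRoot ((1 : ℝ) / 4) → NonProlif2

/-! ## §8 R5 — the stronger sibling item stmt-5837 closes S -/

/-- `QuantFreeBoxShattering` (route PercHollowCells, stmt-CriticalPhenomena-5837: the same sum
`≤ C L^{17/8}`) implies S(1/2) (`≤ C R^{5/2}`) since `R^{17/8} ≤ R^{5/2}` for `R ≥ 1`. -/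
theorem crux_of_quantFreeBoxShattering
    (h : Summit.CriticalPhenomena.PercolationContinuityZ3.Theses.PercHollowCells.QuantFreeBoxShattering) :
    FreeSusceptibilityPowerSaving := by
  obtain ⟨C, hC⟩ := h
  refine ⟨max C 0, fun R hR => ?_⟩
  have hR1 : (1 : ℝ) ≤ (R : ℝ) := by exact_mod_cast hR
  have hR0 : (0 : ℝ) ≤ (R : ℝ) := Nat.cast_nonneg _
  calc chiF R ≤ C * (R : ℝ) ^ ((17 : ℝ) / 8) := hC R hR
    _ ≤ max C 0 * (R : ℝ) ^ ((17 : ℝ) / 8) :=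
        mul_le_mul_of_nonneg_right (le_max_left _ _) (Real.rpow_nonneg hR0 _)
    _ ≤ max C 0 * (R : ℝ) ^ ((5 : ℝ) / 2) :=
        mul_le_mul_of_nonneg_left (Real.rpow_le_rpow_of_exponent_le hR1 (by norm_num))
          (le_max_right _ _)

end

end Summit.CriticalPhenomena.PercolationContinuityZ3.Cruxes.FreeSusceptibilityPowerSaving.CensusS1
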